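import Summits.Parity.BatemanHorn.Theorems.AlmostPrimeZerosLinearCappedRepulsionRankinMajorant

/-!
# Crux `SystemZeroRepulsion` (stmt-Parity-11291), line `smooth-rough-lattice-acquisition` (reshaped,
lead c2): stub `stub_linearRankinMajorant` — the Rankin moment of the capped statistic along `aX + b`

Calibration classes `k = 1`, `f = aX + b` (`a ≥ 1`) of the crux.  With `s(m) = Σ_{p^v ∥ m} min(v,2)`
(`s(0) = 0`): for real `y ≥ 1` and `x ≥ 3`,
`Σ_{0≤n≤x} y^{s((an+b)⁺)} ≤ (|b| + 1) + Σ_{0 ≤ m ≤ ax+|b|} y^{s(m)}` by positivity (`n ↦ (an+b)⁺` is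
injective on `{an + b > 0}`, the other `n` contribute `y⁰ = 1` each and number at most `|b| + 1`), and the
landed `stub_rankinMajorant` (crux `LinearCappedRepulsion`, `f = X`) bounds the right side; the level
change `x ↦ ax + |b|` costs `log log(ax+|b|) ≤ log log x + log(2 + log(a+|b|))` and
`ax + |b| + 1 ≤ (a + |b|)(x + 1)`, absorbed into `B`.  Everything here is PROVED.
-/

noncomputable section

namespace Summit.Parity.BatemanHorn.Cruxes.SystemZeroRepulsion.NearFar

open scoped BigOperators
open Summit.Parity.BatemanHorn.Cruxes.LinearCappedRepulsion.JensenStieltjesMajorant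

/-- A real-valued comparison of sums along an injection. [folklore] -/
private theorem linRankin_sum_le_sum_of_injOn {ι κ : Type*} [DecidableEq κ] (s : Finset ι)
    (t : Finset κ) (e : ι → κ) (f : ι → ℝ) (g : κ → ℝ) (he : Set.InjOn e s)
    (hst : ∀ i ∈ s, e i ∈ t) (hg : ∀ k ∈ t, 0 ≤ g k) (hfg : ∀ i ∈ s, f i ≤ g (e i)) :
    ∑ i ∈ s, f i ≤ ∑ k ∈ t, g k := by
  -- adapted from Literature/NumberTheory/Sieve/HardyLittlewoodChowlaMomentsPrep.lean
  calc ∑ i ∈ s, f i ≤ ∑ i ∈ s, g (e i) := Finset.sum_le_sum hfg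
    _ = ∑ k ∈ s.image e, g k := (Finset.sum_image he).symm
    _ ≤ ∑ k ∈ t, g k :=
        Finset.sum_le_sum_of_subset_of_nonneg (Finset.image_subset_iff.2 hst) fun k hk _ => hg k hk

/-- `log log (M) ≤ log log x + log (c)` when `3 ≤ x`, `1 ≤ c` and `M ≤ x ^ c`... in the elementary form
used below: if `3 ≤ x ≤ M` and `log M ≤ c · log x` with `c ≥ 1` then `log log M ≤ log log x + log c`. -/
private theorem linRankin_loglog_le {x M c : ℝ} (hx : 3 ≤ x) (hxM : x ≤ M) (hc : 1 ≤ c)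
    (hM : Real.log M ≤ c * Real.log x) :
    Real.log (Real.log M) ≤ Real.log (Real.log x) + Real.log c := by
  have hlog3 : 1 < Real.log 3 := by
    rw [Real.lt_log_iff_exp_lt (by norm_num)]
    have := Real.exp_one_lt_d9
    linarith
  have hlx : 1 < Real.log x := hlog3.trans_le (Real.log_le_log (by norm_num) hx)
  have hlx0 : 0 < Real.log x := by linarith
  have hlM : 0 < Real.log M := hlx0.trans_le (Real.log_le_log (by linarith) hxM)
  calc Real.log (Real.log M) ≤ Real.log (c * Real.log x) := Real.log_le_log hlM hM
    _ = Real.log c + Real.log (Real.log x) := Real.log_mul (by linarith) hlx0.ne'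
    _ = Real.log (Real.log x) + Real.log c := add_comm _ _

set_option maxHeartbeats 400000 in
/-- **Stub `stub_linearRankinMajorant`** (classes `k = 1`, `f = aX + b` of the crux
`SystemZeroRepulsion`, line `smooth-rough-lattice-acquisition` reshaped): for `a ≥ 1`, `b ∈ ℤ` there is
`B ≥ 0` with `Σ_{0≤n≤x} y^{s((an+b)⁺)} ≤ (x+1)·exp(B·y·log log x + B·y^{3/2})` for all `x ≥ 3`, `y ≥ 1`.
Proof: positivity and the landed `stub_rankinMajorant` at level `M = ax + |b|` (docstring above);
`B = B₀ + B₀ log(2 + log(a+|b|)) + log(a + 2|b| + 2)` works (`B₀ = 8` from the landed stub). -/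
theorem stub_linearRankinMajorant :
    ∀ (a b : ℤ), 1 ≤ a → ∃ B : ℝ, 0 ≤ B ∧ ∀ x : ℕ, 3 ≤ x → ∀ y : ℝ, 1 ≤ y →
      ∑ n ∈ Finset.range (x + 1), y ^ (((a * (n : ℤ) + b).toNat).factorization.sum fun _ v => min v 2) ≤
        ((x : ℝ) + 1) * Real.exp (B * y * Real.log (Real.log x) + B * y ^ (3 / 2 : ℝ)) := by
  intro a b ha
  obtain ⟨B₀, hB₀, hrank⟩ := stub_rankinMajorant
  -- integer data
  set A : ℕ := a.toNat with hAdef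
  set Bn : ℕ := b.natAbs with hBndef
  have hAa : (A : ℤ) = a := Int.toNat_of_nonneg (by omega)
  have hA1 : 1 ≤ A := by omega
  -- the constants
  set c : ℝ := 2 + Real.log ((A : ℝ) + Bn) with hcdef
  have hABn1 : (1 : ℝ) ≤ (A : ℝ) + Bn := by
    have : (1 : ℝ) ≤ A := by exact_mod_cast hA1
    linarith [(Nat.cast_nonneg Bn : (0 : ℝ) ≤ Bn)]
  have hc1 : 1 ≤ c := by
    have := Real.log_nonneg hABn1
    rw [hcdef]; linarith
  have hlogc : 0 ≤ Real.log c := Real.log_nonneg hc1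
  set K : ℝ := (A : ℝ) + 2 * Bn + 2 with hKdef
  have hK1 : 1 ≤ K := by rw [hKdef]; linarith [(Nat.cast_nonneg Bn : (0 : ℝ) ≤ Bn), hABn1]
  have hlogK : 0 ≤ Real.log K := Real.log_nonneg hK1
  set B : ℝ := B₀ + B₀ * Real.log c + Real.log K with hBdef
  have hB0 : 0 ≤ B := by rw [hBdef]; positivity
  refine ⟨B, hB0, fun x hx y hy => ?_⟩
  have hy0 : 0 ≤ y := by linarith
  have hx3 : (3 : ℝ) ≤ x := by exact_mod_cast hx
  -- the level `M = A x + Bn ≥ x ≥ 3`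
  set M : ℕ := A * x + Bn with hMdef
  have hxM : x ≤ M := by
    calc x = 1 * x := (one_mul x).symm
      _ ≤ A * x := Nat.mul_le_mul_right x hA1
      _ ≤ A * x + Bn := Nat.le_add_right _ _
  have hM3 : 3 ≤ M := hx.trans hxM
  -- split the range: `an + b ≤ 0` versus `an + b > 0`
  set S := Finset.range (x + 1) with hSdef
  set S₀ := S.filter (fun n : ℕ => a * (n : ℤ) + b ≤ 0) with hS₀def
  set S₁ := S.filter (fun n : ℕ => ¬ (a * (n : ℤ) + b ≤ 0)) with hS₁def
  set F : ℕ → ℝ := fun n => y ^ (((a * (n : ℤ) + b).toNat).factorization.sum fun _ v => min v 2)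
    with hFdef
  have hsplit : ∑ n ∈ S, F n = ∑ n ∈ S₀, F n + ∑ n ∈ S₁, F n :=
    (Finset.sum_filter_add_sum_filter_not S (fun n : ℕ => a * (n : ℤ) + b ≤ 0) F).symm
  -- on `S₀` every term is `1`, and `#S₀ ≤ Bn + 1`
  have hS₀val : ∑ n ∈ S₀, F n = (S₀.card : ℝ) := by
    rw [Finset.card_eq_sum_ones, Nat.cast_sum]
    refine Finset.sum_congr rfl fun n hn => ?_
    have hn' := (Finset.mem_filter.1 hn).2
    have h0 : (a * (n : ℤ) + b).toNat = 0 := Int.toNat_of_nonpos hn'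
    simp [hFdef, h0]
  have hS₀card : S₀.card ≤ Bn + 1 := by
    calc S₀.card ≤ (Finset.range (Bn + 1)).card := by
          refine Finset.card_le_card fun n hn => ?_
          have hn' := (Finset.mem_filter.1 hn).2
          rw [Finset.mem_range]
          -- `a n + b ≤ 0`, `a ≥ 1` ⇒ `n ≤ -b ≤ |b|`
          have h1 : (n : ℤ) ≤ a * (n : ℤ) := by nlinarith
          have h2 : (n : ℤ) ≤ -b := by linarith
          have hb : -b ≤ (Bn : ℤ) := by rw [hBndef, ← Int.natAbs_neg]; exact Int.le_natAbs
          have h3 : (n : ℤ) ≤ (Bn : ℤ) := h2.trans hb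
          omega
      _ = Bn + 1 := Finset.card_range _
  -- on `S₁` compare with `Σ_{m ≤ M} y^{s(m)}` along the injection `n ↦ (an+b)⁺`
  have hS₁ : ∑ n ∈ S₁, F n ≤ ∑ m ∈ Finset.range (M + 1), y ^ (m.factorization.sum fun _ v => min v 2) := by
    refine linRankin_sum_le_sum_of_injOn S₁ (Finset.range (M + 1)) (fun n : ℕ => (a * (n : ℤ) + b).toNat) F
      (fun m : ℕ => y ^ (m.factorization.sum fun _ v => min v 2)) ?_ ?_ (fun m _ => by positivity)
      (fun n _ => le_rfl)
    · -- injectivity on `S₁`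
      intro n₁ hn₁ n₂ hn₂ heq
      have h₁ : 0 < a * (n₁ : ℤ) + b := lt_of_not_ge (Finset.mem_filter.1 hn₁).2
      have h₂ : 0 < a * (n₂ : ℤ) + b := lt_of_not_ge (Finset.mem_filter.1 hn₂).2
      have heq' : a * (n₁ : ℤ) + b = a * (n₂ : ℤ) + b := by
        have e₁ := Int.toNat_of_nonneg h₁.le
        have e₂ := Int.toNat_of_nonneg h₂.le
        have : ((a * (n₁ : ℤ) + b).toNat : ℤ) = ((a * (n₂ : ℤ) + b).toNat : ℤ) := by
          exact_mod_cast heq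
        rw [e₁, e₂] at this
        exact this
      have : (n₁ : ℤ) = n₂ := by
        have h := mul_left_cancel₀ (show a ≠ 0 by omega) (by linarith : a * (n₁ : ℤ) = a * (n₂ : ℤ))
        exact h
      exact_mod_cast this
    · -- image inside `range (M + 1)`
      intro n hn
      have hnS : n ∈ S := (Finset.mem_filter.1 hn).1
      rw [hSdef, Finset.mem_range] at hnS
      rw [Finset.mem_range]
      have hnx : (n : ℤ) ≤ x := by exact_mod_cast Nat.lt_succ_iff.1 hnS
      have h1 : a * (n : ℤ) + b ≤ a * (x : ℤ) + (Bn : ℤ) := by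
        have : b ≤ (Bn : ℤ) := by rw [hBndef]; exact Int.le_natAbs
        nlinarith
      have h2 : ((a * (n : ℤ) + b).toNat : ℤ) ≤ a * (x : ℤ) + (Bn : ℤ) := by
        rcases le_or_gt 0 (a * (n : ℤ) + b) with h | h
        · rw [Int.toNat_of_nonneg h]; exact h1
        · rw [Int.toNat_of_nonpos h.le]; push_cast; nlinarith
      have h3 : (M : ℤ) = a * (x : ℤ) + (Bn : ℤ) := by rw [hMdef]; push_cast; rw [hAa]
      omega
  -- the landed Rankin moment at level `M`
  have hR := hrank M hM3 y hy
  -- level change: `log log M ≤ log log x + log c`, `M + 1 ≤ (A + Bn) (x + 1)`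
  have hxM' : (x : ℝ) ≤ M := by exact_mod_cast hxM
  have hlogM : Real.log (M : ℝ) ≤ c * Real.log x := by
    have hx0 : (0 : ℝ) < x := by linarith
    have hM0 : (0 : ℝ) < M := by linarith
    have hMle : (M : ℝ) ≤ ((A : ℝ) + Bn) * x := by
      rw [hMdef]; push_cast
      have : (Bn : ℝ) ≤ (Bn : ℝ) * x := le_mul_of_one_le_right (Nat.cast_nonneg Bn) (by linarith)
      nlinarith
    have hlog3 : 1 < Real.log 3 := by
      rw [Real.lt_log_iff_exp_lt (by norm_num)]
      have := Real.exp_one_lt_d9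
      linarith
    have hlx : 1 ≤ Real.log x := (hlog3.trans_le (Real.log_le_log (by norm_num) hx3)).le
    calc Real.log (M : ℝ) ≤ Real.log (((A : ℝ) + Bn) * x) := Real.log_le_log hM0 hMle
      _ = Real.log ((A : ℝ) + Bn) + Real.log x := Real.log_mul (by linarith) hx0.ne'
      _ ≤ c * Real.log x := by
          rw [hcdef]
          have h0 : 0 ≤ Real.log ((A : ℝ) + Bn) := Real.log_nonneg hABn1
          nlinarith
  have hLL : Real.log (Real.log (M : ℝ)) ≤ Real.log (Real.log (x : ℝ)) + Real.log c :=
    linRankin_loglog_le hx3 hxM' hc1 hlogM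
  have hL0 : 0 ≤ Real.log (Real.log (x : ℝ)) := loglog_nonneg hx3
  -- assemble
  have hM1 : (M : ℝ) + 1 ≤ ((A : ℝ) + Bn) * ((x : ℝ) + 1) := by
    rw [hMdef]; push_cast; nlinarith [(Nat.cast_nonneg Bn : (0 : ℝ) ≤ Bn), hABn1]
  have htot : ∑ n ∈ S, F n ≤ ((Bn : ℝ) + 1) + ((M : ℝ) + 1) *
      Real.exp (B₀ * y * Real.log (Real.log M) + B₀ * y ^ (3 / 2 : ℝ)) := by
    rw [hsplit, hS₀val]
    have : (S₀.card : ℝ) ≤ (Bn : ℝ) + 1 := by exact_mod_cast hS₀card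
    linarith [hS₁.trans hR]
  clear hsplit hS₀val hS₀card hS₁ hR
  -- `exp` bookkeeping
  have hy32 : y ≤ y ^ (3 / 2 : ℝ) := by
    calc y = y ^ (1 : ℝ) := (Real.rpow_one y).symm
      _ ≤ y ^ (3 / 2 : ℝ) := Real.rpow_le_rpow_of_exponent_le hy (by norm_num)
  have hexp1 : Real.exp (B₀ * y * Real.log (Real.log M) + B₀ * y ^ (3 / 2 : ℝ)) ≤
      Real.exp (B₀ * y * Real.log (Real.log x) + (B₀ * Real.log c + B₀) * y ^ (3 / 2 : ℝ)) := by
    refine Real.exp_le_exp.2 ?_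
    have h1 : B₀ * y * Real.log (Real.log (M : ℝ)) ≤ B₀ * y * (Real.log (Real.log (x : ℝ)) + Real.log c) :=
      mul_le_mul_of_nonneg_left hLL (by positivity)
    have h2 : B₀ * y * Real.log c ≤ B₀ * Real.log c * y ^ (3 / 2 : ℝ) := by
      have := mul_le_mul_of_nonneg_left hy32 (show 0 ≤ B₀ * Real.log c by positivity)
      linarith [this]
    nlinarith [h1, h2]
  have hE : 1 ≤ Real.exp (B₀ * y * Real.log (Real.log x) + (B₀ * Real.log c + B₀) * y ^ (3 / 2 : ℝ)) :=
    Real.one_le_exp (by positivity)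
  have hstep : ∑ n ∈ S, F n ≤ K * ((x : ℝ) + 1) *
      Real.exp (B₀ * y * Real.log (Real.log x) + (B₀ * Real.log c + B₀) * y ^ (3 / 2 : ℝ)) := by
    have hP : 0 < ((x : ℝ) + 1) *
        Real.exp (B₀ * y * Real.log (Real.log x) + (B₀ * Real.log c + B₀) * y ^ (3 / 2 : ℝ)) := by
      positivity
    have h1 : ((M : ℝ) + 1) * Real.exp (B₀ * y * Real.log (Real.log M) + B₀ * y ^ (3 / 2 : ℝ)) ≤
        ((A : ℝ) + Bn) * (((x : ℝ) + 1) *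
          Real.exp (B₀ * y * Real.log (Real.log x) + (B₀ * Real.log c + B₀) * y ^ (3 / 2 : ℝ))) := by
      rw [← mul_assoc]
      exact mul_le_mul hM1 hexp1 (Real.exp_pos _).le (by positivity)
    have h2 : (Bn : ℝ) + 1 ≤ ((Bn : ℝ) + 1) * (((x : ℝ) + 1) *
        Real.exp (B₀ * y * Real.log (Real.log x) + (B₀ * Real.log c + B₀) * y ^ (3 / 2 : ℝ))) :=
      le_mul_of_one_le_right (by positivity) (one_le_mul_of_one_le_of_one_le (by linarith) hE)
    have h3 : ((Bn : ℝ) + 1) + ((A : ℝ) + Bn) ≤ K := by rw [hKdef]; linarith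
    calc ∑ n ∈ S, F n ≤ ((Bn : ℝ) + 1) + ((M : ℝ) + 1) *
          Real.exp (B₀ * y * Real.log (Real.log M) + B₀ * y ^ (3 / 2 : ℝ)) := htot
      _ ≤ ((Bn : ℝ) + 1) * (((x : ℝ) + 1) *
          Real.exp (B₀ * y * Real.log (Real.log x) + (B₀ * Real.log c + B₀) * y ^ (3 / 2 : ℝ))) +
          ((A : ℝ) + Bn) * (((x : ℝ) + 1) *
          Real.exp (B₀ * y * Real.log (Real.log x) + (B₀ * Real.log c + B₀) * y ^ (3 / 2 : ℝ))) :=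
          add_le_add h2 h1
      _ = (((Bn : ℝ) + 1) + ((A : ℝ) + Bn)) * (((x : ℝ) + 1) *
          Real.exp (B₀ * y * Real.log (Real.log x) + (B₀ * Real.log c + B₀) * y ^ (3 / 2 : ℝ))) := by
          ring
      _ ≤ K * (((x : ℝ) + 1) *
          Real.exp (B₀ * y * Real.log (Real.log x) + (B₀ * Real.log c + B₀) * y ^ (3 / 2 : ℝ))) :=
          mul_le_mul_of_nonneg_right h3 hP.le
      _ = _ := by ring
  -- `K = exp (log K) ≤ exp (log K · y^{3/2})`
  have hKexp : K * Real.exp (B₀ * y * Real.log (Real.log x) + (B₀ * Real.log c + B₀) * y ^ (3 / 2 : ℝ)) ≤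
      Real.exp (B * y * Real.log (Real.log x) + B * y ^ (3 / 2 : ℝ)) := by
    have hy1' : 1 ≤ y ^ (3 / 2 : ℝ) := Real.one_le_rpow hy (by norm_num)
    have hK0 : 0 < K := lt_of_lt_of_le one_pos hK1
    have h2 : Real.log K ≤ Real.log K * y ^ (3 / 2 : ℝ) := le_mul_of_one_le_right hlogK hy1'
    have h3 : B₀ * y * Real.log (Real.log x) ≤ B * y * Real.log (Real.log x) := by
      have : B₀ ≤ B := by rw [hBdef]; linarith [mul_nonneg hB₀ hlogc]
      exact mul_le_mul_of_nonneg_right (mul_le_mul_of_nonneg_right this hy0) hL0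
    have h4 : (B₀ * Real.log c + B₀) * y ^ (3 / 2 : ℝ) + Real.log K * y ^ (3 / 2 : ℝ) = B * y ^ (3 / 2 : ℝ) := by
      rw [hBdef]; ring
    calc K * Real.exp (B₀ * y * Real.log (Real.log x) + (B₀ * Real.log c + B₀) * y ^ (3 / 2 : ℝ))
        = Real.exp (Real.log K) *
            Real.exp (B₀ * y * Real.log (Real.log x) + (B₀ * Real.log c + B₀) * y ^ (3 / 2 : ℝ)) := by
          rw [Real.exp_log hK0]
      _ = Real.exp (Real.log K +
            (B₀ * y * Real.log (Real.log x) + (B₀ * Real.log c + B₀) * y ^ (3 / 2 : ℝ))) :=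
          (Real.exp_add _ _).symm
      _ ≤ Real.exp (B * y * Real.log (Real.log x) + B * y ^ (3 / 2 : ℝ)) :=
          Real.exp_le_exp.2 (by linarith)
  calc ∑ n ∈ Finset.range (x + 1), y ^ (((a * (n : ℤ) + b).toNat).factorization.sum fun _ v => min v 2)
      = ∑ n ∈ S, F n := rfl
    _ ≤ K * ((x : ℝ) + 1) * Real.exp (B₀ * y * Real.log (Real.log x) + (B₀ * Real.log c + B₀) * y ^ (3 / 2 : ℝ)) := hstep
    _ = ((x : ℝ) + 1) * (K * Real.exp (B₀ * y * Real.log (Real.log x) + (B₀ * Real.log c + B₀) * y ^ (3 / 2 : ℝ))) := by ring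
    _ ≤ ((x : ℝ) + 1) * Real.exp (B * y * Real.log (Real.log x) + B * y ^ (3 / 2 : ℝ)) :=
        mul_le_mul_of_nonneg_left hKexp (by positivity)

end Summit.Parity.BatemanHorn.Cruxes.SystemZeroRepulsion.NearFar

end
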